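import Literature.NumberTheory.Automorphic.AdelicCommutativeDatumMultiplicityOne
import Literature.NumberTheory.Automorphic.GLOneStandardLTate
import HarnessLib

/-!
# The eigencharacter of an irreducible closed constituent of `L²` of a COMMUTATIVE adelic group datum

Topic `NumberTheory/Automorphic`; namespace `Literature.NumberTheory.Automorphic` (dot notation on ★ `AdelicGroupData`).
Definitions WITH BODY and proved theorems only: no named fact, no instance, no notation, no `sorry`.  Companion: ★
`AutomorphicCharacterLine` (the line of a character; the dictionary «discrete automorphic representations of a torus = its
automorphic characters»).

For an adelic group datum `𝒢` over a number field `K` (★ `AdelicGroupData`) and an automorphic measure `μ` on the automorphic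
quotient `X = G(𝔸_K) ⧸ A_G G(K)` (★ `IsAutomorphicMeasure`), the right regular representation `R` on `L²(X, μ)`
(`(R g f)(x) = f(g⁻¹ • x)`, ★ `rightRegular`) is unitary and strongly continuous.  This file is the GENERIC form (any datum
whose adelic group is commutative, hypothesis `hcomm`) of ★ `GLOneStandardLTate` §EigenCharacter (there for `GL₁(𝔸_K)`, whose
cuspidal automorphic representations are the unitary Hecke characters), written so that the anisotropic unitary tori
`U(1)_{L/L⁺}` (★ `UnitaryGroup.cmDatum L 1 H`, commutative by ★ `cmDatum_one_mul_comm`) and their products (the endoscopic groups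
`U(1) × U(1)`, `U(1) × U(1) × U(1)` of [Rogawski1990, §4.6, §11.1]) can use it:

* §1 **the eigencharacter** (`hcomm`).  On a topologically irreducible closed `W ≤ L²` every `R(g)` acts by a scalar
  (Schur, ★ `IsTopIrreducible.exists_apply_eq_smul_of_commute`): `AdelicGroupData.eigenvalue`, continuous (strong continuity ★
  `isStronglyContinuous_rightRegular_holds`), of absolute value `1` (`R` is isometric) and trivial on `A_G · G(K)` (★
  `rightRegular_apply_eq_self_of_mem_quotientSubgroup`), bundled as the unitary automorphic character
  **`AdelicGroupData.eigencharacter μ hcomm hW : 𝒢.AutomorphicCharacter`** (★ `AutomorphicTwist`): `R(g)|_W = eigencharacter g`.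
* §2 **uniqueness** (`G(𝔸_K)` locally compact second countable): two irreducible closed `W₁, W₂ ≤ L²` with the same
  eigencharacter COINCIDE (`closedSubrep_eq_of_eigenvalue_eq`, `closedSubrep_eq_of_eigencharacter_eq`) — both are lines (★
  `finrank_eq_one_of_isTopIrreducible_of_mul_comm`) and a `χ`-eigenfunction orthogonal to a non-zero `χ`-eigenfunction vanishes
  (★ `eq_zero_of_inner_eq_zero_of_rightRegular_apply_eq_smul`, ergodicity of `G(𝔸_K)` on the automorphic quotient
  [Gelbart1975, Thm. 10.10, proof p. 158]: «one-dimensional constituents occur once»).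

HC_CM is proved only modulo the printed citations until rung 0 closes; this file proves no printed citation of that programme.

## References
* [Gelbart1975] S. Gelbart, *Automorphic forms on adele groups*, Ann. of Math. Stud. 83 (1975), §2.A; Thm. 10.10 (proof, p. 158).
* [DeitmarEchterhoff2014] A. Deitmar, S. Echterhoff, *Principles of Harmonic Analysis*, 2nd ed. (2014), Lemma 6.1.7, Example 6.1.10.
* [Rogawski1990] J. Rogawski, *Automorphic representations of unitary groups in three variables*, Ann. of Math. Stud. 123 (1990),
  §4.6 Prop. 4.6.1, §11.1 (the endoscopic tori).
-/

noncomputable section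

open MeasureTheory NumberField
open scoped InnerProductSpace

namespace Literature.NumberTheory.Automorphic

universe u

/-! ## §1 The eigencharacter of an irreducible closed `W ≤ L²` of a commutative datum -/

namespace AdelicGroupData

variable {K : Type} [Field K] [NumberField K] (𝒢 : AdelicGroupData.{u} K)
  (μ : Measure 𝒢.automorphicQuotient) [𝒢.IsAutomorphicMeasure μ]
  {W : ContRepresentation.ClosedSubrep (𝒢.rightRegular μ)}

/-- The regular representation restricted to a closed subrepresentation `W ≤ L²` acts by isometries
(★ `norm_rightRegular_apply`). [cite: BorelJacquet1979, §4.6] -/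
theorem norm_toContRep_apply_eq (g : 𝒢.Adelic) (f : W.toSubmodule) : ‖W.toContRep g f‖ = ‖f‖ := by
  rw [Submodule.coe_norm, ContRepresentation.ClosedSubrep.coe_toContRep_apply, 𝒢.norm_rightRegular_apply,
    ← Submodule.coe_norm]

/-- **Schur for a commutative datum.** If `G(𝔸_K)` is commutative, then on a topologically irreducible closed
subrepresentation `W` of `L²(G(𝔸_K) ⧸ A_G G(K), μ)` every `R(g)` acts by a scalar: `R(g)|_W` commutes with the irreducible unitary
representation `W`. [cite: DeitmarEchterhoff2014, Lemma 6.1.7] -/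
theorem exists_toContRep_apply_eq_smul_of_mul_comm (hcomm : ∀ g h : 𝒢.Adelic, g * h = h * g)
    (hW : W.toContRep.IsTopIrreducible) (g : 𝒢.Adelic) : ∃ c : ℂ, ∀ f : W.toSubmodule, W.toContRep g f = c • f := by
  haveI : CompleteSpace W.toSubmodule := W.isClosed.completeSpace_coe
  have hU : W.toContRep.IsUnitary := ClosedSubrep.isUnitary_toContRep (𝒢.isUnitary_rightRegular μ) W
  exact hW.exists_apply_eq_smul_of_commute hU fun h => (show Commute h g from hcomm h g).map W.toContRep

/-- The **eigenvalue** `ω_W(g)` by which `R(g)` acts on the irreducible `W ≤ L²` of a commutative datum.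
[cite: DeitmarEchterhoff2014, Example 6.1.10] -/
def eigenvalue (hcomm : ∀ g h : 𝒢.Adelic, g * h = h * g) (hW : W.toContRep.IsTopIrreducible) (g : 𝒢.Adelic) : ℂ :=
  (𝒢.exists_toContRep_apply_eq_smul_of_mul_comm μ hcomm hW g).choose

/-- `R(g) f = ω_W(g) f` for `f ∈ W`. [cite: DeitmarEchterhoff2014, Example 6.1.10] -/
theorem toContRep_apply_eq_eigenvalue_smul (hcomm : ∀ g h : 𝒢.Adelic, g * h = h * g) (hW : W.toContRep.IsTopIrreducible)
    (g : 𝒢.Adelic) (f : W.toSubmodule) :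
    W.toContRep g f = 𝒢.eigenvalue μ hcomm hW g • f :=
  (𝒢.exists_toContRep_apply_eq_smul_of_mul_comm μ hcomm hW g).choose_spec f

/-- `R(g) f = ω_W(g) f` in `L²`, for `f ∈ W`. [cite: DeitmarEchterhoff2014, Example 6.1.10] -/
theorem rightRegular_apply_eq_eigenvalue_smul (hcomm : ∀ g h : 𝒢.Adelic, g * h = h * g) (hW : W.toContRep.IsTopIrreducible)
    (g : 𝒢.Adelic) {f : 𝒢.L2 μ} (hf : f ∈ W) :
    𝒢.rightRegular μ g f = 𝒢.eigenvalue μ hcomm hW g • f :=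
  congrArg Subtype.val (𝒢.toContRep_apply_eq_eigenvalue_smul μ hcomm hW g ⟨f, hf⟩)

omit [𝒢.IsAutomorphicMeasure μ] in
/-- An irreducible `W` has a non-zero vector. [cite: DeitmarEchterhoff2014, Example 6.1.10] -/
theorem exists_ne_zero_of_isTopIrreducible [SMulInvariantMeasure 𝒢.Adelic 𝒢.automorphicQuotient μ]
    {W : ContRepresentation.ClosedSubrep (𝒢.rightRegular μ)} (hW : W.toContRep.IsTopIrreducible) :
    ∃ f : W.toSubmodule, f ≠ 0 := by
  haveI := ((ContRepresentation.isTopIrreducible_iff _).mp hW).1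
  exact exists_ne (0 : W.toSubmodule)

/-- `|ω_W(g)| = 1`: `R(g)` is an isometry of `L²`. [cite: DeitmarEchterhoff2014, Example 6.1.10] -/
theorem norm_eigenvalue (hcomm : ∀ g h : 𝒢.Adelic, g * h = h * g) (hW : W.toContRep.IsTopIrreducible)
    (g : 𝒢.Adelic) : ‖𝒢.eigenvalue μ hcomm hW g‖ = 1 := by
  obtain ⟨f, hf⟩ := 𝒢.exists_ne_zero_of_isTopIrreducible μ hW
  have h := 𝒢.norm_toContRep_apply_eq μ g f
  rw [𝒢.toContRep_apply_eq_eigenvalue_smul μ hcomm hW g f, norm_smul] at h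
  exact (mul_eq_right₀ (norm_ne_zero_iff.mpr hf)).mp h

/-- `ω_W(g) ≠ 0`. [cite: DeitmarEchterhoff2014, Example 6.1.10] -/
theorem eigenvalue_ne_zero (hcomm : ∀ g h : 𝒢.Adelic, g * h = h * g) (hW : W.toContRep.IsTopIrreducible)
    (g : 𝒢.Adelic) : 𝒢.eigenvalue μ hcomm hW g ≠ 0 := by
  rw [← norm_ne_zero_iff, 𝒢.norm_eigenvalue μ hcomm hW g]
  exact one_ne_zero

/-- The eigenvalue is `1` at every element fixing a non-zero vector of `W`. [cite: DeitmarEchterhoff2014, Example 6.1.10] -/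
theorem eigenvalue_eq_one_of_apply_eq (hcomm : ∀ g h : 𝒢.Adelic, g * h = h * g) (hW : W.toContRep.IsTopIrreducible)
    {x : 𝒢.Adelic} {f : W.toSubmodule} (hf : f ≠ 0) (hx : W.toContRep x f = f) :
    𝒢.eigenvalue μ hcomm hW x = 1 := by
  have h := 𝒢.toContRep_apply_eq_eigenvalue_smul μ hcomm hW x f
  rw [hx] at h
  have h' : 𝒢.eigenvalue μ hcomm hW x • f = (1 : ℂ) • f := by rw [one_smul]; exact h.symm
  exact smul_left_injective ℂ hf h'

/-- `ω_W(1) = 1`. [cite: DeitmarEchterhoff2014, Example 6.1.10] -/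
theorem eigenvalue_one (hcomm : ∀ g h : 𝒢.Adelic, g * h = h * g) (hW : W.toContRep.IsTopIrreducible) : 𝒢.eigenvalue μ hcomm hW 1 = 1 := by
  obtain ⟨f, hf⟩ := 𝒢.exists_ne_zero_of_isTopIrreducible μ hW
  refine 𝒢.eigenvalue_eq_one_of_apply_eq μ hcomm hW hf ?_
  rw [map_one]
  rfl

/-- `ω_W(g h) = ω_W(g) ω_W(h)`. [cite: DeitmarEchterhoff2014, Example 6.1.10] -/
theorem eigenvalue_mul (hcomm : ∀ g h : 𝒢.Adelic, g * h = h * g) (hW : W.toContRep.IsTopIrreducible) (g h : 𝒢.Adelic) :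
    𝒢.eigenvalue μ hcomm hW (g * h) = 𝒢.eigenvalue μ hcomm hW g * 𝒢.eigenvalue μ hcomm hW h := by
  obtain ⟨f, hf⟩ := 𝒢.exists_ne_zero_of_isTopIrreducible μ hW
  have h1 : 𝒢.eigenvalue μ hcomm hW (g * h) • f = (𝒢.eigenvalue μ hcomm hW g * 𝒢.eigenvalue μ hcomm hW h) • f :=
    calc 𝒢.eigenvalue μ hcomm hW (g * h) • f = W.toContRep (g * h) f :=
          (𝒢.toContRep_apply_eq_eigenvalue_smul μ hcomm hW _ f).symm
      _ = W.toContRep g (W.toContRep h f) := by rw [map_mul]; rfl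
      _ = W.toContRep g (𝒢.eigenvalue μ hcomm hW h • f) := by rw [𝒢.toContRep_apply_eq_eigenvalue_smul μ hcomm hW h f]
      _ = 𝒢.eigenvalue μ hcomm hW h • W.toContRep g f := map_smul _ _ _
      _ = 𝒢.eigenvalue μ hcomm hW h • (𝒢.eigenvalue μ hcomm hW g • f) := by
          rw [𝒢.toContRep_apply_eq_eigenvalue_smul μ hcomm hW g f]
      _ = (𝒢.eigenvalue μ hcomm hW h * 𝒢.eigenvalue μ hcomm hW g) • f := smul_smul _ _ _
      _ = (𝒢.eigenvalue μ hcomm hW g * 𝒢.eigenvalue μ hcomm hW h) • f := by rw [mul_comm (𝒢.eigenvalue μ hcomm hW h)]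
  exact smul_left_injective ℂ hf h1

/-- The eigenvalues as a monoid homomorphism `ω_W : G(𝔸_K) →* ℂ`. [cite: DeitmarEchterhoff2014, Example 6.1.10] -/
def eigenvalueHom (hcomm : ∀ g h : 𝒢.Adelic, g * h = h * g) (hW : W.toContRep.IsTopIrreducible) : 𝒢.Adelic →* ℂ where
  toFun := 𝒢.eigenvalue μ hcomm hW
  map_one' := 𝒢.eigenvalue_one μ hcomm hW
  map_mul' := 𝒢.eigenvalue_mul μ hcomm hW

/-- Unfolding `eigenvalueHom`. [cite: DeitmarEchterhoff2014, Example 6.1.10] -/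
@[simp] theorem eigenvalueHom_apply (hcomm : ∀ g h : 𝒢.Adelic, g * h = h * g) (hW : W.toContRep.IsTopIrreducible)
    (g : 𝒢.Adelic) : 𝒢.eigenvalueHom μ hcomm hW g = 𝒢.eigenvalue μ hcomm hW g := rfl

/-- **Continuity of the eigenvalue**, from the strong continuity of the regular representation
(★ `isStronglyContinuous_rightRegular_holds`): for `0 ≠ f ∈ W`, `ω_W(g) = ⟪f, R(g) f⟫ / ⟪f, f⟫`. [cite: DeitmarEchterhoff2014, Example 6.1.10] -/
theorem continuous_eigenvalue (hcomm : ∀ g h : 𝒢.Adelic, g * h = h * g) (hW : W.toContRep.IsTopIrreducible)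
    : Continuous (𝒢.eigenvalue μ hcomm hW) := by
  obtain ⟨f, hf⟩ := 𝒢.exists_ne_zero_of_isTopIrreducible μ hW
  have hsc := 𝒢.isStronglyContinuous_rightRegular_holds μ (f : 𝒢.L2 μ)
  have hcont : Continuous fun g : 𝒢.Adelic => W.toContRep g f := by
    refine continuous_induced_rng.2 ?_
    simp only [Function.comp_def, ContRepresentation.ClosedSubrep.coe_toContRep_apply]
    exact hsc
  have hff : (⟪f, f⟫_ℂ : ℂ) ≠ 0 := inner_self_ne_zero.mpr hf
  have heq : 𝒢.eigenvalue μ hcomm hW = fun g => ⟪f, W.toContRep g f⟫_ℂ / ⟪f, f⟫_ℂ := by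
    funext g
    have h1 : ⟪f, W.toContRep g f⟫_ℂ = 𝒢.eigenvalue μ hcomm hW g * ⟪f, f⟫_ℂ := by
      rw [𝒢.toContRep_apply_eq_eigenvalue_smul μ hcomm hW g f]
      exact inner_smul_right f f _
    rw [h1, mul_div_assoc, div_self hff, mul_one]
  rw [heq]
  exact (continuous_const.inner hcont).div_const _

/-- **The eigenvalue is `1` on `A_G · G(K)`**: for a commutative datum `R(γ) = 1` on `L²` for `γ ∈ A_G · G(K)`
(★ `rightRegular_apply_eq_self_of_mem_quotientSubgroup`). [cite: DeitmarEchterhoff2014, Example 6.1.10] -/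
theorem eigenvalue_eq_one_of_mem_quotientSubgroup (hcomm : ∀ g h : 𝒢.Adelic, g * h = h * g) (hW : W.toContRep.IsTopIrreducible)
    {γ : 𝒢.Adelic} (hγ : γ ∈ 𝒢.quotientSubgroup) :
    𝒢.eigenvalue μ hcomm hW γ = 1 := by
  obtain ⟨f, hf⟩ := 𝒢.exists_ne_zero_of_isTopIrreducible μ hW
  exact 𝒢.eigenvalue_eq_one_of_apply_eq μ hcomm hW hf
    (Subtype.ext (𝒢.rightRegular_apply_eq_self_of_mem_quotientSubgroup μ hcomm hγ f))

/-- **The eigencharacter of an irreducible closed `W ≤ L²` of a commutative datum**, as a UNITARY AUTOMORPHIC CHARACTER of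
`G(𝔸_K)` (★ `AutomorphicCharacter`: continuous, `|·| = 1`, trivial on `A_G · G(K)`): `R(g)|_W = eigencharacter g`.  For `GL₁`
this is `GLOne.heckeCharacter` read on `GL₁(𝔸_K)`. [cite: Gelbart1975, §2.A] [cite: DeitmarEchterhoff2014, Example 6.1.10] -/
def eigencharacter (hcomm : ∀ g h : 𝒢.Adelic, g * h = h * g) (hW : W.toContRep.IsTopIrreducible) : 𝒢.AutomorphicCharacter where
  toMonoidHom := (𝒢.eigenvalueHom μ hcomm hW).toHomUnits
  continuous_coe := 𝒢.continuous_eigenvalue μ hcomm hW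
  norm_apply := 𝒢.norm_eigenvalue μ hcomm hW
  map_eq_one_of_mem _ hg := Units.ext (𝒢.eigenvalue_eq_one_of_mem_quotientSubgroup μ hcomm hW hg)

/-- Unfolding: `eigencharacter g = ω_W(g)` in `ℂ`. [cite: DeitmarEchterhoff2014, Example 6.1.10] -/
@[simp] theorem coe_eigencharacter_apply (hcomm : ∀ g h : 𝒢.Adelic, g * h = h * g) (hW : W.toContRep.IsTopIrreducible) (g : 𝒢.Adelic) :
    ((𝒢.eigencharacter μ hcomm hW g : ℂˣ) : ℂ) = 𝒢.eigenvalue μ hcomm hW g := rfl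

/-- `R(g) f = eigencharacter(g) • f` for `f ∈ W`. [cite: DeitmarEchterhoff2014, Example 6.1.10] -/
theorem toContRep_apply_eq_eigencharacter_smul (hcomm : ∀ g h : 𝒢.Adelic, g * h = h * g) (hW : W.toContRep.IsTopIrreducible)
    (g : 𝒢.Adelic) (f : W.toSubmodule) :
    W.toContRep g f = ((𝒢.eigencharacter μ hcomm hW g : ℂˣ) : ℂ) • f :=
  𝒢.toContRep_apply_eq_eigenvalue_smul μ hcomm hW g f

/-- `R(g) f = eigencharacter(g) • f` in `L²`, for `f ∈ W`. [cite: DeitmarEchterhoff2014, Example 6.1.10] -/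
theorem rightRegular_apply_eq_eigencharacter_smul (hcomm : ∀ g h : 𝒢.Adelic, g * h = h * g) (hW : W.toContRep.IsTopIrreducible)
    (g : 𝒢.Adelic) {f : 𝒢.L2 μ} (hf : f ∈ W) :
    𝒢.rightRegular μ g f = ((𝒢.eigencharacter μ hcomm hW g : ℂˣ) : ℂ) • f :=
  𝒢.rightRegular_apply_eq_eigenvalue_smul μ hcomm hW g hf

/-! ## §2 Uniqueness: an irreducible closed `W ≤ L²` is determined by its eigencharacter -/

section Uniqueness

variable [LocallyCompactSpace 𝒢.Adelic] [SecondCountableTopology 𝒢.Adelic]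

/-- **Two irreducible closed subrepresentations of `L²` of a commutative datum with the same eigenvalues coincide.**  Both are lines
(★ `finrank_eq_one_of_isTopIrreducible_of_mul_comm`) spanned by `χ`-eigenfunctions `a`, `b` of the SAME `χ`; the component of `b`
orthogonal to `a` is again a `χ`-eigenfunction, hence `0` (★ `eq_zero_of_inner_eq_zero_of_rightRegular_apply_eq_smul`, ergodicity of
`G(𝔸_K)` on the automorphic quotient), so `b ∈ W₁` and `W₂ = W₁` by irreducibility. [cite: Gelbart1975, Thm. 10.10 (proof, p. 158)] -/
theorem closedSubrep_eq_of_eigenvalue_eq (hcomm : ∀ g h : 𝒢.Adelic, g * h = h * g) {W₁ W₂ : ContRepresentation.ClosedSubrep (𝒢.rightRegular μ)}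
    (hW₁ : W₁.toContRep.IsTopIrreducible) (hW₂ : W₂.toContRep.IsTopIrreducible)
    (h : ∀ g, 𝒢.eigenvalue μ hcomm hW₁ g = 𝒢.eigenvalue μ hcomm hW₂ g) : W₁ = W₂ := by
  -- generators of the two lines
  obtain ⟨v, hv0, hv⟩ := finrank_eq_one_iff'.1 (𝒢.finrank_eq_one_of_isTopIrreducible_of_mul_comm μ hcomm W₁ hW₁)
  obtain ⟨w, hw0, hw⟩ := finrank_eq_one_iff'.1 (𝒢.finrank_eq_one_of_isTopIrreducible_of_mul_comm μ hcomm W₂ hW₂)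
  set a : 𝒢.L2 μ := (v : 𝒢.L2 μ) with ha_def
  set b : 𝒢.L2 μ := (w : 𝒢.L2 μ) with hb_def
  have ha : ∀ g, 𝒢.rightRegular μ g a = 𝒢.eigenvalue μ hcomm hW₁ g • a := fun g =>
    𝒢.rightRegular_apply_eq_eigenvalue_smul μ hcomm hW₁ g v.2
  have hb : ∀ g, 𝒢.rightRegular μ g b = 𝒢.eigenvalue μ hcomm hW₁ g • b := fun g => by
    rw [h g]
    exact 𝒢.rightRegular_apply_eq_eigenvalue_smul μ hcomm hW₂ g w.2
  have ha0 : a ≠ 0 := fun h0 => hv0 (Subtype.ext h0)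
  have hb0 : b ≠ 0 := fun h0 => hw0 (Subtype.ext h0)
  -- the component of `b` orthogonal to `a` vanishes
  set c₀ : ℂ := ⟪a, b⟫_ℂ / ⟪a, a⟫_ℂ with hc₀
  have hh : ∀ g, 𝒢.rightRegular μ g (b - c₀ • a) = 𝒢.eigenvalue μ hcomm hW₁ g • (b - c₀ • a) := by
    intro g
    rw [map_sub, map_smul, ha g, hb g, smul_sub, smul_comm]
  have horth : ⟪a, b - c₀ • a⟫_ℂ = 0 := by
    rw [inner_sub_right, inner_smul_right, hc₀, div_mul_cancel₀ _ (inner_self_ne_zero.2 ha0), sub_self]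
  have h0 : b - c₀ • a = 0 := 𝒢.eq_zero_of_inner_eq_zero_of_rightRegular_apply_eq_smul μ ha hh ha0 horth
  have hb_mem : b ∈ W₁ := by
    rw [sub_eq_zero] at h0
    rw [h0]
    exact W₁.toSubmodule.smul_mem c₀ v.2
  -- `W₂` is the line through `b`, hence contained in `W₁`
  have hle : W₂ ≤ W₁ := by
    intro x hx
    obtain ⟨c, hc⟩ := hw ⟨x, hx⟩
    have hx' : x = c • b := (congrArg Subtype.val hc).symm
    rw [hx']
    exact W₁.toSubmodule.smul_mem c hb_mem
  have hnt : Nontrivial W₂.toSubmodule := ⟨⟨w, 0, hw0⟩⟩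
  exact (ContRepresentation.ClosedSubrep.eq_of_le_of_isTopIrreducible hW₁ hnt hle).symm

/-- **Two irreducible closed subrepresentations of `L²` of a commutative datum with the same eigencharacter coincide.**
[cite: Gelbart1975, Thm. 10.10 (proof, p. 158)] -/
theorem closedSubrep_eq_of_eigencharacter_eq (hcomm : ∀ g h : 𝒢.Adelic, g * h = h * g) {W₁ W₂ : ContRepresentation.ClosedSubrep (𝒢.rightRegular μ)}
    (hW₁ : W₁.toContRep.IsTopIrreducible) (hW₂ : W₂.toContRep.IsTopIrreducible)
    (h : 𝒢.eigencharacter μ hcomm hW₁ = 𝒢.eigencharacter μ hcomm hW₂) : W₁ = W₂ :=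
  𝒢.closedSubrep_eq_of_eigenvalue_eq μ hcomm hW₁ hW₂ fun g => by
    rw [← coe_eigencharacter_apply, ← coe_eigencharacter_apply, h]

end Uniqueness

end AdelicGroupData

end Literature.NumberTheory.Automorphic

end
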